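import Summits.BirchSwinnertonDyer.BirchSwinnertonDyer.Theorems.AlignedTransportAtTwoMainConjectureOfRankZeroBSDAtTwoFineRoadTwoBranch
import Summits.BirchSwinnertonDyer.BirchSwinnertonDyer.Theorems.AlignedTransportAtTwoMainConjectureOfRankZeroBSDAtTwoSeed
import Literature.NumberTheory.EllipticCurves.PAdicLFunctionMinusIntegralityAtTwoProofs
import HarnessLib

/-!
# Route `AlignedTransportAtTwo`, crux C2 `MainConjectureOfRankZeroBSDAtTwo` (stmt-BirchSwinnertonDyer-22298):
# road (b′) at the crux level — C2 from PRINT + displayed Kato data over `ℚ(i)` + statement (A) over `ℚ(i)`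
# + the ODD-BRANCH analytic `μ₂ = 0`

HONEST FRAMING (cell `bsd-f1-sign2`, lead prover seat `bsd-line-att-p2` gen 2; BSD is NOT proved by any of
this). THEOREMS ONLY; nothing asserted. Continuation of `…FineRoadTwoBranch` (the two-branch `μ`-bookkeeping
over `Λ_G = Λ₀[Δ]` and the per-datum statement `selmerDual_mu_eq_zero_of_twoBranchSkeleton_two`). Here the
data are quantified over the seed cell and composed with p583329:

* `lengthAt_fineSelmerDual_eq_zero_of_finite_twoTorsion_numberField` — statement (A) at `2` for a curve over a
  NUMBER FIELD (`Sel₀(K_∞, E[2^∞])[2]` finite) kills `ℓ_{(2)}` of every dual fine Selmer datum (the `ℚ(i)`-side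
  input; the `ℚ`-version is in `…FineRoad`).
* `seedMuZeroAtTwo_of_fineRoadQi` — stub T of line `birth` from: modularity (PRINT); (K₂′) for every seed-cell
  curve, cyclotomic datum over `ℚ`, newform, and integral lifts `G₊` of `L₂(f, α)` and `G₋` of the odd branch
  `L₂⁻(f, α, ω, T)` (both EXIST unconditionally at good ordinary `2` with `E[2]` irreducible — tree theorems):
  a quadratic field `K` of discriminant `−4`, a `K`-model `V'`, a cyclotomic datum `(κ_K, γ_K)` over `K`, a dual
  fine Selmer datum `Yd_K` of `V'`, abstract `Λ₀`-modules `H, P, X'` with the Poitou–Tate row `H → P → X' → Yd_K`,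
  an injective Coleman map `col : P → Λ₀ × Λ₀`, two classes with `col (loc z₁) = (a,b)`, `col (loc z₂) = (b,a)`,
  `a + b = s₊·G₊`, `a − b = s₋·G₋`, `s_± ∉ (2)` (Kato's `(c,d)`-factors), and a descent map `X' → X(W/ℚ_∞)` with
  finite cokernel — ALL DISPLAYED (printed statements at `2` awaiting typing and the `×2` audit of (17.13.1);
  nothing here asserts them); (Mu⁻) the odd-branch analytic `μ₂ = 0` on the seed cell (`red G₋ ≠ 0`; NEW cell
  binder, finitely checkable per seed); (A₂′) statement (A) at `2` for the `K`-models of seed-cell curves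
  (⟸ Lim 2017 Thm. 3.5 over `ℚ(i)` + Iwasawa 1973 + classical `μ = 0` of the cubic field `ℚ(e₁)` — the first two
  not yet typed for base `ℚ(i)`, displayed). The even-branch `μ₂ = 0` is C2's own binder.
* `mainConjectureOfRankZeroBSDAtTwo_of_fineRoadQi` — C2 BY NAME, conditional, through p583329.

Compared with road (b) (`…FineRoadCrux`): the construction target at `(2)` is GONE; the new non-print inputs
are (Mu⁻) and statement (A) over `ℚ(i)`; the «± object at 2» is now explicit: the odd branch `L₂⁻(E, χ₋₄, T)`
and the finite descent defect `H¹(Δ, E(K_∞)[2^∞])`.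

References: K. Kato, Astérisque 295 (2004), §12.1, Thm. 12.6, (14.9.3), Thm. 16.6, Prop. 17.11, §17.13;
B. Mazur, J. Tate, J. Teitelbaum, Invent. Math. 84 (1986) §I.12–I.13 (the two branches);
J. Coates, R. Sujatha, Math. Ann. 331 (2005) §3; R. Greenberg, LNM 1716 (1999) Conj. 1.11, Thm. 4.1.
-/

set_option linter.dupNamespace false
set_option autoImplicit false

noncomputable section

open scoped Classical

open Literature.NumberTheory.EllipticCurves Literature.NumberTheory.EllipticCurves.Module

namespace Summit.BirchSwinnertonDyer.BirchSwinnertonDyer.Theorems.AlignedTransportAtTwoFineRoad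

/-! ## §1 Statement (A) at `2` over a number field kills `ℓ_{(2)}` of the dual fine Selmer datum -/

section NumberField

open WeierstrassCurve Literature.NumberTheory.EllipticCurves.IwasawaModuleFinitePadicInt

/-- **Statement (A) at `(E_K, 2)` kills the `(2)`-length of the dual fine Selmer group**, `K` any number
field: `Sel₀(K_∞, E[2^∞])[2]` finite ⟹ `ℓ_{(2)}(X₀(E/K_∞)) = 0` for every Pontryagin-dual datum w.r.t. a
topological generator (Pontryagin algebra of the tree: finite generation over `Λ`, `X₀/2X₀` finite, torsion,
`μ = 0`). [cite: CoatesSujatha2005, statement (A) (§3)] [cite: GreenbergLNM1716, §1 p. 60 (after Conj. 1.3)] -/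
theorem lengthAt_fineSelmerDual_eq_zero_of_finite_twoTorsion_numberField {K : Type} [Field K]
    [NumberField K] (V : WeierstrassCurve K) {κ : ZpExtension K 2} {γ : Field.absoluteGaloisGroup K}
    (hγ : κ.IsTopGenerator γ) (Yd : V.FineSelmerDualData κ γ)
    (hA : Set.Finite {s : V.fineSelmerInfty κ | 2 • s = 0}) :
    lengthAt (IwasawaAlgebra 2) Yd.X
      ⟨IwasawaAlgebra.augIdealP 2, IwasawaAlgebra.isPrime_augIdealP_holds 2⟩ = 0 := by
  haveI : Module.Finite (IwasawaAlgebra 2) Yd.X := Yd.module_finite_of_finite_pTorsion hγ hA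
  have hq := Yd.finite_quotient_augIdealP_of_finite_pTorsion hA
  have hT : Module.IsTorsion (IwasawaAlgebra 2) Yd.X :=
    isTorsion_of_finite_quotient_augIdealP 2 Yd.X hq
  have hμ : muInvariant 2 Yd.X = 0 := muInvariant_eq_zero_of_finite_quotient_augIdealP 2 Yd.X hT hq
  have hne := lengthAt_ne_top_of_isTorsion 2 Yd.X hT
    ⟨IwasawaAlgebra.augIdealP 2, IwasawaAlgebra.isPrime_augIdealP_holds 2⟩ rfl
  rw [muInvariant_eq_toNat_lengthAt 2 Yd.X
    ⟨IwasawaAlgebra.augIdealP 2, IwasawaAlgebra.isPrime_augIdealP_holds 2⟩ rfl] at hμ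
  rcases ENat.toNat_eq_zero.mp hμ with h | h
  · exact h
  · exact absurd h hne

/-- `(p)` is prime: a product of two elements outside `(p)` is outside `(p)`. [folklore] -/
theorem mul_not_mem_augIdealP {p : ℕ} [Fact p.Prime] {s G : IwasawaAlgebra p}
    (hs : s ∉ IwasawaAlgebra.augIdealP p) (hG : G ∉ IwasawaAlgebra.augIdealP p) :
    s * G ∉ IwasawaAlgebra.augIdealP p := fun h =>
  ((IwasawaAlgebra.isPrime_augIdealP_holds p).mem_or_mem h).elim hs hG

end NumberField

/-! ## §2 The crux on road (b′) -/

section Crux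

open CongruenceSubgroup WeierstrassCurve Literature.NumberTheory.EllipticCurves.ModularForms
  Literature.NumberTheory.EllipticCurves.Greenberg1999
  Literature.NumberTheory.EllipticCurves.Rank1Residual
  Summit.BirchSwinnertonDyer.Rank1Residual Summit.BirchSwinnertonDyer.Rank1Residual.X1.MuLambda
  Summit.BirchSwinnertonDyer.Rank1Residual.X5 Summit.BirchSwinnertonDyer.Rank1Residual.F1Sign2
  Summit.BirchSwinnertonDyer.BirchSwinnertonDyer.Theorems.Rank1ResidualX1Defs
  Summit.BirchSwinnertonDyer.BirchSwinnertonDyer.Theses.AlignedTransportAtTwo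

/-- **Stub T of line `birth` on road (b′)** (see the module docstring for the reading of each displayed
hypothesis: `hK2'` = Kato's §17.13 data over `ℚ(ζ_{2^∞})` for a `ℚ(i)`-model with injective Coleman map to
`Λ_G`, the two zeta classes, the `(c,d)`-factors `s_±`, and the finite-cokernel descent; `hMuMinus` = the
odd-branch analytic `μ₂ = 0`; `hA2K` = statement (A) at `2` over `ℚ(i)`). The even-branch `μ₂ = 0` is the
crux's own binder and is used (`red G₊ ≠ 0`). Conclusion: `μ₂(X(W/ℚ_∞)) = 0` for every seed-cell curve and
every cyclotomic dual datum. [cite: Kato2004Asterisque, §12.1, Thm. 12.6, Thm. 16.6, Prop. 17.11, §17.13 (pp. 219–280)]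
[cite: MazurTateTeitelbaum1986Invent, §I.12–I.13] [cite: CoatesSujatha2005, statement (A) (§3)] -/
theorem seedMuZeroAtTwo_of_fineRoadQi (hmod : nonempty_modularParametrizationData)
    (hK2' : ∀ (W : WeierstrassCurve ℚ) [W.IsElliptic] [W.IsGloballyMinimal], IsOrdinaryAt W 2 →
      (∀ x : ℚ, ¬ HasRationalTwoTorsionX W x) →
      ∀ (κ : ZpExtension ℚ 2) (γ : Field.absoluteGaloisGroup ℚ), κ.IsCyclotomic →
      κ.IsTopGenerator γ → IsCyclotomicVariable 2 γ →
      ∀ ⦃N : ℕ⦄ [NeZero N] (f : CuspForm (Gamma0 N) 2), IsNewformOf W f →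
      ∀ Gp Gm : IwasawaAlgebra 2,
        iwasawaToPowerSeries 2 Gp = padicLFunction f (unitRoot W 2 : ℚ_[2]) →
        iwasawaToPowerSeries 2 Gm = padicLFunctionMinusBranch f (unitRoot W 2 : ℚ_[2]) 1 →
      ∀ D : W.SelmerDualData κ γ,
        ∃ (K : Type) (_ : Field K) (_ : NumberField K) (V' : WeierstrassCurve K)
          (κK : ZpExtension K 2) (γK : Field.absoluteGaloisGroup K) (YdK : V'.FineSelmerDualData κK γK)
          (H P X' : Type) (_ : AddCommGroup H) (_ : _root_.Module (IwasawaAlgebra 2) H)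
          (_ : AddCommGroup P) (_ : _root_.Module (IwasawaAlgebra 2) P)
          (_ : AddCommGroup X') (_ : _root_.Module (IwasawaAlgebra 2) X')
          (loc : H →ₗ[IwasawaAlgebra 2] P) (toX : P →ₗ[IwasawaAlgebra 2] X')
          (π : X' →ₗ[IwasawaAlgebra 2] YdK.X)
          (col : P →ₗ[IwasawaAlgebra 2] IwasawaAlgebra 2 × IwasawaAlgebra 2)
          (z₁ z₂ : H) (a b sp sm : IwasawaAlgebra 2) (fd : X' →ₗ[IwasawaAlgebra 2] D.X),
          Module.finrank ℚ K = 2 ∧ NumberField.discr K = -4 ∧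
          (∃ C : VariableChange K, C • W.baseChange K = V') ∧ κK.IsCyclotomic ∧ κK.IsTopGenerator γK ∧
          Function.Injective col ∧ (∀ h, toX (loc h) = 0) ∧ Function.Exact toX π ∧
          col (loc z₁) = (a, b) ∧ col (loc z₂) = (b, a) ∧ a + b = sp * Gp ∧ a - b = sm * Gm ∧
          sp ∉ IwasawaAlgebra.augIdealP 2 ∧ sm ∉ IwasawaAlgebra.augIdealP 2 ∧
          Finite (D.X ⧸ LinearMap.range fd))
    (hMuMinus : ∀ (W : WeierstrassCurve ℚ) [W.IsElliptic] [W.IsGloballyMinimal], ¬ W.HasCM →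
      IsOrdinaryAt W 2 → (∀ x : ℚ, ¬ HasRationalTwoTorsionX W x) → ¬ IsSquare W.Δ →
      W.analyticRank = 0 → BSDp W 2 →
      ∀ ⦃N : ℕ⦄ [NeZero N] (f : CuspForm (Gamma0 N) 2), IsNewformOf W f →
      ∀ Gm : IwasawaAlgebra 2,
        iwasawaToPowerSeries 2 Gm = padicLFunctionMinusBranch f (unitRoot W 2 : ℚ_[2]) 1 → red Gm ≠ 0)
    (hA2K : ∀ (W : WeierstrassCurve ℚ) [W.IsElliptic] [W.IsGloballyMinimal], ¬ W.HasCM →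
      IsOrdinaryAt W 2 → (∀ x : ℚ, ¬ HasRationalTwoTorsionX W x) → ¬ IsSquare W.Δ →
      W.analyticRank = 0 → BSDp W 2 →
      ∀ (K : Type) [Field K] [NumberField K] (V' : WeierstrassCurve K),
        Module.finrank ℚ K = 2 → NumberField.discr K = -4 →
        (∃ C : VariableChange K, C • W.baseChange K = V') →
        ∀ κK : ZpExtension K 2, κK.IsCyclotomic → Set.Finite {s : V'.fineSelmerInfty κK | 2 • s = 0}) :
    ∀ (W : WeierstrassCurve ℚ) [W.IsElliptic] [W.IsGloballyMinimal], ¬ W.HasCM →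
      IsOrdinaryAt W 2 → (∀ x : ℚ, ¬ HasRationalTwoTorsionX W x) → ¬ IsSquare W.Δ →
      W.analyticRank = 0 →
      (∀ ⦃N : ℕ⦄ [NeZero N] (f : CuspForm (Gamma0 N) 2), IsNewformOf W f →
        ∀ G : IwasawaAlgebra 2, IsEvenBranchLiftAtTwo W f G → red G ≠ 0) →
      BSDp W 2 →
      ∀ (κ : ZpExtension ℚ 2) (γ : Field.absoluteGaloisGroup ℚ), κ.IsCyclotomic →
        κ.IsTopGenerator γ → IsCyclotomicVariable 2 γ →
        ∀ D : W.SelmerDualData κ γ, D.IsTorsion → D.mu = 0 := by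
  intro W _ _ hcm hord ht hsq hr hμan hbsd κ γ hκ hγ hγ' D _
  have hirr : Irr W 2 := AlignedTransportAtTwoSeed.irr_two_of_forall_not_hasRationalTwoTorsionX W ht
  haveI : NeZero (W.conductorNorm ℤ) := ⟨(W.conductorNorm_pos_holds).ne'⟩
  obtain ⟨Dm⟩ := hmod W
  obtain ⟨Gp, hGp⟩ := exists_iwasawaToPowerSeries_eq_padicLFunction_two hord Dm.isNewformOf hirr
  obtain ⟨Gm, hGm⟩ :=
    exists_iwasawaToPowerSeries_eq_padicLFunctionMinusBranch_two hord Dm.isNewformOf odd_one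
  have hredp : red Gp ≠ 0 := hμan Dm.f Dm.isNewformOf Gp (Or.inl ⟨hord, hGp⟩)
  have hredm : red Gm ≠ 0 := hMuMinus W hcm hord ht hsq hr hbsd Dm.f Dm.isNewformOf Gm hGm
  obtain ⟨K, _, _, V', κK, γK, YdK, H, P, X', _, _, _, _, _, _, loc, toX, π, col, z₁, z₂, a, b, sp,
    sm, fd, hK2, hK4, hV', hκK, hγK, hcol, h0, hX, hz₁, hz₂, hab, hamb, hsp, hsm, hfd⟩ :=
    hK2' W hord ht κ γ hκ hγ hγ' Dm.f Dm.isNewformOf Gp Gm hGp hGm D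
  have hA := hA2K W hcm hord ht hsq hr hbsd K V' hK2 hK4 hV' κK hκK
  have hY := lengthAt_fineSelmerDual_eq_zero_of_finite_twoTorsion_numberField V' hγK YdK hA
  have ha : a + b ∉ IwasawaAlgebra.augIdealP 2 :=
    hab ▸ mul_not_mem_augIdealP hsp (not_mem_augIdealP_of_red_ne_zero hredp)
  have hb : a - b ∉ IwasawaAlgebra.augIdealP 2 :=
    hamb ▸ mul_not_mem_augIdealP hsm (not_mem_augIdealP_of_red_ne_zero hredm)
  haveI := hfd
  exact selmerDual_mu_eq_zero_of_twoBranchSkeleton_two W D loc toX π col hcol h0 hX hz₁ hz₂ ha hb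
    hY fd hfd

/-- **C2 BY NAME on road (b′).** PRINT {Kato 17.4 (1)(2) at `2`, Greenberg 4.1, period unit, modularity,
GZK} + the displayed Kato data over `ℚ(i)` (K₂′) + the odd-branch analytic `μ₂ = 0` on the seed cell (Mu⁻)
+ statement (A) at `2` over `ℚ(i)` for the seeds (A₂′) ⟹ `MainConjectureOfRankZeroBSDAtTwo`. CONDITIONAL:
the item stays open; compare roads (a) (`…Seed`, Greenberg Conj. 1.11 at `2`) and (b) (`…FineRoadCrux`,
construction target at `(2)` + classical `μ` of cubic fields). [cite: Kato2004Asterisque, Thm. 17.4 (p. 273) and §17.13 (pp. 279–280)]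
[cite: MazurTateTeitelbaum1986Invent, §I.12–I.13] [cite: GreenbergLNM1716, Thm. 4.1 (p. 102) and Conj. 1.11 (p. 58)] -/
theorem mainConjectureOfRankZeroBSDAtTwo_of_fineRoadQi
    (h17 : ∀ (V : WeierstrassCurve ℚ) [V.IsElliptic] [V.IsGloballyMinimal] [NeZero (V.conductorNorm ℤ)]
      (f : CuspForm (Gamma0 (V.conductorNorm ℤ)) 2), kato_divisibility_allPrimes V 2 (f := f))
    (hGr : Greenberg1999.thm41_charValue_rankZero_anyPrime)
    (hper : realPeriodRat_eq_unit_mul_plusPeriod_two) (hmod : nonempty_modularParametrizationData)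
    (hGZK : rank_eq_analyticRank_of_analyticRank_le_one)
    (hK2' : ∀ (W : WeierstrassCurve ℚ) [W.IsElliptic] [W.IsGloballyMinimal], IsOrdinaryAt W 2 →
      (∀ x : ℚ, ¬ HasRationalTwoTorsionX W x) →
      ∀ (κ : ZpExtension ℚ 2) (γ : Field.absoluteGaloisGroup ℚ), κ.IsCyclotomic →
      κ.IsTopGenerator γ → IsCyclotomicVariable 2 γ →
      ∀ ⦃N : ℕ⦄ [NeZero N] (f : CuspForm (Gamma0 N) 2), IsNewformOf W f →
      ∀ Gp Gm : IwasawaAlgebra 2,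
        iwasawaToPowerSeries 2 Gp = padicLFunction f (unitRoot W 2 : ℚ_[2]) →
        iwasawaToPowerSeries 2 Gm = padicLFunctionMinusBranch f (unitRoot W 2 : ℚ_[2]) 1 →
      ∀ D : W.SelmerDualData κ γ,
        ∃ (K : Type) (_ : Field K) (_ : NumberField K) (V' : WeierstrassCurve K)
          (κK : ZpExtension K 2) (γK : Field.absoluteGaloisGroup K) (YdK : V'.FineSelmerDualData κK γK)
          (H P X' : Type) (_ : AddCommGroup H) (_ : _root_.Module (IwasawaAlgebra 2) H)
          (_ : AddCommGroup P) (_ : _root_.Module (IwasawaAlgebra 2) P)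
          (_ : AddCommGroup X') (_ : _root_.Module (IwasawaAlgebra 2) X')
          (loc : H →ₗ[IwasawaAlgebra 2] P) (toX : P →ₗ[IwasawaAlgebra 2] X')
          (π : X' →ₗ[IwasawaAlgebra 2] YdK.X)
          (col : P →ₗ[IwasawaAlgebra 2] IwasawaAlgebra 2 × IwasawaAlgebra 2)
          (z₁ z₂ : H) (a b sp sm : IwasawaAlgebra 2) (fd : X' →ₗ[IwasawaAlgebra 2] D.X),
          Module.finrank ℚ K = 2 ∧ NumberField.discr K = -4 ∧
          (∃ C : VariableChange K, C • W.baseChange K = V') ∧ κK.IsCyclotomic ∧ κK.IsTopGenerator γK ∧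
          Function.Injective col ∧ (∀ h, toX (loc h) = 0) ∧ Function.Exact toX π ∧
          col (loc z₁) = (a, b) ∧ col (loc z₂) = (b, a) ∧ a + b = sp * Gp ∧ a - b = sm * Gm ∧
          sp ∉ IwasawaAlgebra.augIdealP 2 ∧ sm ∉ IwasawaAlgebra.augIdealP 2 ∧
          Finite (D.X ⧸ LinearMap.range fd))
    (hMuMinus : ∀ (W : WeierstrassCurve ℚ) [W.IsElliptic] [W.IsGloballyMinimal], ¬ W.HasCM →
      IsOrdinaryAt W 2 → (∀ x : ℚ, ¬ HasRationalTwoTorsionX W x) → ¬ IsSquare W.Δ →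
      W.analyticRank = 0 → BSDp W 2 →
      ∀ ⦃N : ℕ⦄ [NeZero N] (f : CuspForm (Gamma0 N) 2), IsNewformOf W f →
      ∀ Gm : IwasawaAlgebra 2,
        iwasawaToPowerSeries 2 Gm = padicLFunctionMinusBranch f (unitRoot W 2 : ℚ_[2]) 1 → red Gm ≠ 0)
    (hA2K : ∀ (W : WeierstrassCurve ℚ) [W.IsElliptic] [W.IsGloballyMinimal], ¬ W.HasCM →
      IsOrdinaryAt W 2 → (∀ x : ℚ, ¬ HasRationalTwoTorsionX W x) → ¬ IsSquare W.Δ →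
      W.analyticRank = 0 → BSDp W 2 →
      ∀ (K : Type) [Field K] [NumberField K] (V' : WeierstrassCurve K),
        Module.finrank ℚ K = 2 → NumberField.discr K = -4 →
        (∃ C : VariableChange K, C • W.baseChange K = V') →
        ∀ κK : ZpExtension K 2, κK.IsCyclotomic → Set.Finite {s : V'.fineSelmerInfty κK | 2 • s = 0}) :
    MainConjectureOfRankZeroBSDAtTwo :=
  AlignedTransportAtTwoSeed.mainConjectureOfRankZeroBSDAtTwo_of_seedMuZero h17 hGr hper hmod hGZK
    (seedMuZeroAtTwo_of_fineRoadQi hmod hK2' hMuMinus hA2K)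

end Crux

end Summit.BirchSwinnertonDyer.BirchSwinnertonDyer.Theorems.AlignedTransportAtTwoFineRoad

end
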